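import Mathlib
import Summits.QuantumFields.Balaban3D.Carriers.Standard
import Summits.QuantumFields.Balaban3D.Proofs.Bound46Series
import Summits.QuantumFields.Balaban3D.Proofs.ScalesArithmetic

/-!
# `Summit.QuantumFields.Balaban3D.Proofs.Bound46Std` — lane «pub-balaban3d» (Bałaban, CMP **102** (1985) 255–275, d = 3 lattice UV
# stability AS PRINTED), prover seat p2: LEAF-LEDGER row B15 — `B10Assembly.LeafSystem.bound46` ((46) p. 267) AT THE LANE'S STANDARD
# TOWER INPUT `Carriers.stdTowerInput X K 𝔖` (seat p1 v1.3), from the per-step bound of `…Proofs.Bound46Series`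

HONEST FRAMING (lane PLAN.md §0).  Nothing of [B10] = [Balaban1985UV3] is asserted.  `bound46_stdTowerInput` concludes LITERALLY the
`LeafSystem.bound46` field for `(stdTowerInput X K 𝔖).tower3.toTowerRun` with `C46 := (C_old + C_new)·M₁⁻³`.  HYPOTHESES, by class:
(α) DATA DISPLAY (44) p. 267 about the previous-scale data `oldVal` at every step (`h44` — the SAME binder as seat p5's C10, ruling
R-44) with its degree floor «n ≥ 2» (`hfloor`); the NEWBORN SLICE `hnew` («|PY_k + PYZ_k| ≤ C_new·(g_kp(g_k))²·|Ω_{k+1}^{(k+1)}|»,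
(33)–(34) p. 264 / (61) p. 271 — owner per lead); the coupling window `g_k ≤ γ₄₆` («for g_{k−1} sufficiently small», (45)); the VOLUME
IDENTIFICATION `Λvol (k+1) h = min |Ω_{k+1}^{(k+1)}(h)| |T₁^{(k+1)}| ≥ #LamFin k h` is DISCHARGED here (p1 Regions v1.3c, ruling R-LAMVOL; seat p3
`sites_eq_card`); signs of the constants.  Window facts `0 < g_k ≤ 1` (seat p3 `ScalesArithmetic`) are discharged here.
-/

noncomputable section

namespace Summit.QuantumFields.Balaban3D.Proofs.Bound46Std

open Literature.MathematicalPhysics.QuantumFieldTheory.Balaban1983to89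
open Literature.MathematicalPhysics.QuantumFieldTheory.Balaban1985CMP102
open Literature.MathematicalPhysics.QuantumFieldTheory.Balaban1985CMP102.Setting
open Summit.QuantumFields.Balaban3D.Carriers
open B10SectCExpansion (Bound44)
open Summit.QuantumFields.Balaban3D.Proofs.ScalesArithmetic (gk_pos gk_le_one sites_eq_card)
open Summit.QuantumFields.Balaban3D.Proofs.Bound46Series (abs_pint_succ_le_gamma bound46_series_of_steps)
open Summit.QuantumFields.Balaban3D.Proofs.Thresholds (gammaOf)
open Finset

variable {L : ℕ} {S : Scales L} {G : Type} [GaugeGroup G] [MeasurableSpace G] [HaarData G]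
  {V : Type} [NormedAddCommGroup V] [NormedSpace ℂ V]

/-- **`B10Assembly.LeafSystem.bound46` AT THE LANE'S STANDARD TOWER INPUT** (LEAF-LEDGER B15; (46) p. 267 «Σ_{j=1}^k Σ_{Y_j}|𝒫_j(Y_j, U_k)|
≤ O(1)M₁³g²_{k−1}p²(g_{k−1})|Λ_k|», literally the field type for `(stdTowerInput X K 𝔖).tower3.toTowerRun`, `C46 := (C_old + C_new)·M₁⁻³`,
`C_old = 2C(8L²B₃Z′(κ₁/M₁))²L⁴/(L−1)`): per step `k → k+1` the OLD SLICE of `Pint (k+1) = PoldIn_k + PY_k + PYZ_k` is bounded from the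
display (44) about `oldVal` (`h44`, `hfloor`, threshold `hγ46`) by `Bound46Series.abs_pint_succ_le_gamma`, the NEWBORN SLICE is the input
`hnew` (ruling R-46N: seat p6's `newborn46_series`), and the volume `#LamFin = |Ω_{k+1}^{(k+1)}(h)| ≤ Λvol (k+1) h` is DISCHARGED
(p1 `LamVol_succ_eq_card_lamFin`, p3 `sites_eq_card`).  `0 < g_k ≤ 1` on the window from seat p3's `gk_pos`/`gk_le_one`. [cite: Balaban1985UV3, (44)–(46) p.267 + (33)–(34) p.264] -/
theorem bound46_stdTowerInput (X : ExternalInputs S G) (K : CarrierConsts) (𝔖 : ∀ k, StepSeries S G V (nblkOf S K k) k)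
    {κ₁ B₃ C Cnew : ℝ} (hC : 0 ≤ C) (hCnew : 0 ≤ Cnew) (hB : 0 ≤ B₃) (hκ₁ : 0 < κ₁)
    (hM : 0 < K.M₁) (hb₀ : 0 < K.b₀) (hp₀ : 0 < K.p₀)
    (h44 : ∀ k, k + 1 ≤ S.K → ∀ (h : Hist S.P (k + 1)) (U : GaugeField S.P (k + 1) G), ∀ j ∈ Icc 1 k,
      Bound44 (oldGeom S.P k j) (fun y n c => (𝔖 k).oldVal h U j y n c) κ₁ (K.M₁ : ℝ) (ell S.P k j) (L : ℝ) B₃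
        (S.gk k) (B10.pFun K.b₀ K.p₀ (S.gk k)) C)
    (hfloor : ∀ k, k + 1 ≤ S.K → ∀ (h : Hist S.P (k + 1)) (U : GaugeField S.P (k + 1) G), ∀ j ∈ Icc 1 k,
      ∀ (y : Site S.P j) (n : ℕ) (c : Fin n → PBond S.P j), (𝔖 k).oldVal h U j y n c ≠ 0 → 2 ≤ n)
    (hγ46 : ∀ k, k + 1 ≤ S.K → S.gk k ≤ gammaOf K.b₀ K.p₀ (1 / (2 * (8 * (L : ℝ) ^ 2 * B₃ *
        (2 / (κ₁ / K.M₁) * (24 * (48 / (κ₁ / K.M₁ / 2) ^ 3 * Real.exp (κ₁ / K.M₁ / 2 / 2) /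
          (1 - Real.exp (-(κ₁ / K.M₁ / 2 / 2)))) * 1))))))
    (hnew : ∀ k, k + 1 ≤ S.K → ∀ (h : Hist S.P (k + 1)) (U : GaugeField S.P (k + 1) G),
      |(𝔖 k).PY h U + (𝔖 k).PYZ h U| ≤
        Cnew * (S.gk k * B10.pFun K.b₀ K.p₀ (S.gk k)) ^ 2 * (LamFin K.M₁ (rcolOf S K) k h).card) :
    ∀ k, 1 ≤ k → k ≤ (stdTowerInput X K 𝔖).tower3.toTowerRun.K →
      ∀ (h : (stdTowerInput X K 𝔖).tower3.toTowerRun.Hist k) (U : (stdTowerInput X K 𝔖).tower3.toTowerRun.Cfg k),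
        |(stdTowerInput X K 𝔖).tower3.toTowerRun.Pint k h U| ≤
          ((2 * C * (8 * (L : ℝ) ^ 2 * B₃ *
              (2 / (κ₁ / K.M₁) * (24 * (48 / (κ₁ / K.M₁ / 2) ^ 3 * Real.exp (κ₁ / K.M₁ / 2 / 2) /
                (1 - Real.exp (-(κ₁ / K.M₁ / 2 / 2)))) * 1))) ^ 2 * ((L : ℝ) ^ 4 / ((L : ℝ) - 1)) + Cnew) *
              ((K.M₁ : ℝ)⁻¹) ^ 3) *
            (stdTowerInput X K 𝔖).tower3.toTowerRun.M₁ ^ 3 *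
            (((stdTowerInput X K 𝔖).tower3.toTowerRun.g (k - 1)) ^ 2 *
              (B10.pFun (stdTowerInput X K 𝔖).tower3.toTowerRun.b₀ (stdTowerInput X K 𝔖).tower3.toTowerRun.p₀
                ((stdTowerInput X K 𝔖).tower3.toTowerRun.g (k - 1))) ^ 2) *
            (stdTowerInput X K 𝔖).tower3.toTowerRun.Λvol k h := by
  have hL1 : (1 : ℝ) < L := by exact_mod_cast S.hL.2
  have hA : 0 ≤ 2 * C * (8 * (L : ℝ) ^ 2 * B₃ *
      (2 / (κ₁ / K.M₁) * (24 * (48 / (κ₁ / K.M₁ / 2) ^ 3 * Real.exp (κ₁ / K.M₁ / 2 / 2) /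
        (1 - Real.exp (-(κ₁ / K.M₁ / 2 / 2)))) * 1))) ^ 2 * ((L : ℝ) ^ 4 / ((L : ℝ) - 1)) + Cnew := by
    have : 0 < (L : ℝ) - 1 := by linarith
    positivity
  -- the volume identification (ruling R-LAMVOL): `Λvol (k+1) h = min |Ω_{k+1}^{(k+1)}(h)| |T₁^{(k+1)}|` and `#LamFin ≤ #T^{(k+1)} = |T₁^{(k+1)}|`
  have hΛ : ∀ k, k + 1 ≤ S.K → ∀ (h : Hist S.P (k + 1)),
      ((LamFin K.M₁ (rcolOf S K) k h).card : ℝ) ≤ (stdTowerInput X K 𝔖).tower3.toTowerRun.Λvol (k + 1) h := by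
    intro k hk h
    show ((LamFin K.M₁ (rcolOf S K) k h).card : ℝ) ≤ min (LamVol K.M₁ (rcolOf S K) (k + 1) h : ℝ) (S.sites (k + 1))
    rw [LamVol_succ_eq_card_lamFin]
    refine le_min le_rfl ?_
    rw [sites_eq_card S (k + 1) (by omega)]
    exact_mod_cast card_le_univ _
  exact bound46_series_of_steps (X.toTowerBase K) 𝔖 (piecesParamsOf S K) hM
    (fun k hk h U => abs_pint_succ_le_gamma (X.toTowerBase K) 𝔖 (piecesParamsOf S K) k (by omega) hC hB hκ₁ hM hb₀ hp₀
      (gk_pos S k) (gk_le_one S S.gK_le_one k (by omega)) (h44 k hk) (hfloor k hk) (hγ46 k hk) (hnew k hk) h U)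
    hA hΛ

end Summit.QuantumFields.Balaban3D.Proofs.Bound46Std

end
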